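/-
Copyright: the b2b-balaban cell (near-miss cell 7), T⁴-continuum CRUX team (coordinator ruling e34b3e0c item (2)),
row-NE7b OWNER lineage `t4-ne7b-p1` (gen 103). Released under the licence of the surrounding project.
-/
import Summits.QuantumFields.BalabanUV.T4Continuum.Support.HistoryAssemblyTreesLE
import Summits.QuantumFields.BalabanUV.T4Continuum.Support.HistoryAssemblyMult
import Summits.QuantumFields.BalabanUV.T4Continuum.Spine.NE7b.PinnedExtraction

/-!
# NE7b's COUNT EXIT OVER TREE SLOTS, RE-CUT AT THE RELATIVE CLASS DISPLAY: the numerator asked AT THE CLASS WEIGHT,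
# RELATIVE to the full sum — no sup-dressing, no (2.50) floor, no curly envelope, no (B)-side input at this level
# (row NE7b, owner rulings W-ne7bp1-g103-1∕-2; memo `t4/b2b-balaban-t4-ne7b-p1/g103/F-RHO-TOWER-g103.md` §§4, 6)

Crux-route work under `Spine/NE7b/` (rung (B)+1 on a FINITE torus only; NOT infinite volume, NOT the mass gap, NOT Clay;
NOT a proof of NE7b — `T4WeightBudget.RelWeightBound`, the cell's OWN estimate, NOT PRINTED, NOT PROVED).  [folklore]
COMPOSITION BY NAME of landed theorems; no definition, no `Prop` of Bałaban's minted, no `[cite:]` tag, zero `sorry`.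

WHY.  `HistoryAssemblyTreesLE.hybridNE7_of_treeBinders_canonLE` (leaf-02 gen 2, row S4c (iii)) feeds the count road of record
(`HistoryExitLE` → `HistoryTreeShapeLE` → `T4BranchingRecordsGas` → `T4LiveGasToTerms`) with two `Regeneration` runs built by
`HistoryRegeneration.regeneration_pair_of_cor3With` from the TERM-WISE numerator readings `up ∕ resum` (dead-past factor ×
live price × envelope `nup ≤ Nup`), the dressing ∕ (α) rows, the (2.50) floor `c₀` and the site budget — the envelope constant
`constOf l₀ B (max (e₋ g) 0) n₁ c₀ Nup`.  The owner's located findings F-ne7bp1-g103-1∕2 show that at Bałaban's own run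
the K-uniform `Nup` does not exist (bare-field entropy `1∕Z_K`; free dead large-field gas), so that road is vacuous at the
intended instance.  The count road consumes the two runs ONLY through `Regeneration.globalDom`; and a RELATIVE class-level
display inhabits `Regeneration` with the FULL SUM as both envelopes and constant `1`
(`PinnedExtraction.regeneration_of_relativeClasses`).  THIS FILE is the exit RE-COMPOSED on that input: the SAME statement
as `hybridNE7_of_treeBinders_canonLE` except that (i) the (B)-side rows (`SignConventions`, `Cor3With`, observable, (α),
(γ)-floor, sites), the envelopes `nup mup Nup` and the term-wise rows `up dead_nonneg resum up' dead'_nonneg resum'` are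
GONE, replaced by the two relative class displays `fibRel ∕ fibRel'` («the bad class weight is at most its live price
times the full sum», both runs) and the non-negativity of the weights on `T K`; (ii) the envelope constant is `1`.
Conclusion: `HybridNE7` with weights `1 · recordsBudget (birthMass C) κ₁ n^d L^d (log 2) jhalf`.  §2 `fibRel_coarse` (the `_rel`
twin of `HistoryAssemblyMult.resum_coarse`) carries the relative display from the FINE member families to the COARSE slot classes —
the first brick of the «count DERIVED» road IR-103-2.

WHAT REMAINS DISPLAYED (census).  CONSTANTS: `ThresholdOK`, `0 < C.μ`, `d·log L + 2·log 2 ≤ κ₁`, `log (2 + birthMass C)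
≤ E₀`, `n`, caps.  FLOW (⇐ BetaPertH, displayed): box β-bounds, `γb ≤ γ₀`, `γb²β′ < 1`, `SmallnessFor`, `pe ≥ p₀, rr`,
tuning, `irThresholdTLE ≤ log g⁻²`, (2.5) side condition.  H3: **the two RELATIVE class displays `fibRel`, `fibRel′`**
(for Bałaban's tower: «the partial sum over the histories carrying a pinned old live class is at most its live price
times the full sum» — print's KIND, [Balaban1989LargeFieldII] (1.79)–(1.89) with the pinned genealogy's operations bounded,
RELATIVE; NOT in print; the row's wall H3^NE7b at partial-sum level), the four tree-slot (ID) binders, `hF ∕ hF′` (live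
price below the slot-price family weight).  SEAM: `ShellWeightBound`, `ReindexedBudget`, four summable rates.  NO (B)-side
input is needed at this level (it re-enters only at the headline, for the full sums' positivity and the source tilt).
HONEST DEPENDENCY (cell): continuum YM on T⁴ ⇐ BetaPertH ∧ nine spine estimates (0/9 proved); BetaPertH ⇐ (D1) ∧ (D4) ∧
CAP+tail; G-an2-4 gates asym, D1 and NE2/3/4.  This file changes none of it.
-/

open Finset MeasureTheory
open Literature.MathematicalPhysics.QuantumFieldTheory.Balaban1983to89
open T4PersistenceDictionary T4PersistentHistoryCount T4BankedInduction T4PrintedShapeBanking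
open T4WeightBudget T4GlobalDenominator T4LiveClassFibration T4LiveStructureGas T4LiveGasToTerms T4RecordPriceSeam
open T4PartnerMultiplicity T4IndicatorShell T4MatchingAssembly T4MatchingClosure T4MatchingClosureSocket T4Continuum
open T4StabilitySocket T4BranchingRecordsGas T4TaggedShapeBanking T4CanonicalMenus T4RenewalChains
open Summit.QuantumFields.BalabanUV.T4Continuum.PlacementBatch
open Summit.QuantumFields.BalabanUV.T4Continuum.PlacementSkeleton
open Summit.QuantumFields.BalabanUV.T4Continuum.CountThresholdUniform
open Summit.QuantumFields.BalabanUV.T4Continuum.CountThresholdExit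
open Summit.QuantumFields.BalabanUV.T4Continuum.CountSeamJunction
open Summit.QuantumFields.BalabanUV.T4Continuum.LateMergers
open Summit.QuantumFields.BalabanUV.T4Continuum.HistoryFlow
open Summit.QuantumFields.BalabanUV.T4Continuum.HistoryRegeneration
open Summit.QuantumFields.BalabanUV.T4Continuum.HistoryTables
open Summit.QuantumFields.BalabanUV.T4Continuum.HistoryAssemblyTrees
open Summit.QuantumFields.BalabanUV.T4Continuum.HistoryBankingLE
open Summit.QuantumFields.BalabanUV.T4Continuum.HistoryExitLE
open Summit.QuantumFields.BalabanUV.T4Continuum.HistoryAssemblyTreesLE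
open Summit.QuantumFields.BalabanUV.T4Continuum.HistoryAssemblyMult
open Summit.QuantumFields.BalabanUV.T4Continuum.HistorySocketTH
open Summit.QuantumFields.BalabanUV.T4Continuum.HistoryAssemblyTerms
open Summit.QuantumFields.BalabanUV.T4Continuum.NE7b.PinnedExtraction

namespace Summit.QuantumFields.BalabanUV.T4Continuum.NE7b.TreeBindersRel

noncomputable section

section ExitLevel

variable {F : T4Family} {G : Type*} [GaugeGroup G] [MeasurableSpace G] [HaarData G]
variable {ε : Type*} [DecidableEq ε]
variable {ι κc : Type*} [DecidableEq κc] [DecidableEq ι] {l₀ vol : ℝ} {K₀ : ℕ} {π : ℕ → ι → κc}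
  {T : ℕ → Finset ι} {A A' shA shB : ℕ → ℝ → ι → ℝ} {Bad' : ℕ → ℝ → Finset κc}
  {Fq Fq' : ℕ → κc → ℝ}
  {Cc Rr CcRec RrRec : ℕ → ℝ → ι → ℝ} {ν u s₂ q₀ r s Wsh : ℕ → ℝ}

/-- **NE7b's COUNT EXIT OVER TREE SLOTS FROM TWO RELATIVE CLASS DISPLAYS** (the re-cut of
`HistoryAssemblyTreesLE.hybridNE7_of_treeBinders_canonLE`): the typed flow along the tuned runs
(`HistoryFlow.flowBinders_of_tuned`, clamped at the cutoff), cells `cellN d n F.L`, matching scale `jhalf`, rates at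
`η̄₊ = log 2` (`treeRates_of_large`), the two `Regeneration` runs INHABITED FROM THE RELATIVE CLASS DISPLAYS with the full
sum as both envelopes and constant `1` (`PinnedExtraction.regeneration_of_relativeClasses`), the LE exit
`HistoryExitLE.relWeightBound_canon_of_irThresholdLE` at `Δ = 1`, then `CountSeamJunction.hybridNE7_of_eventually`.
No (B)-side input, no envelope letters, no floor.  Displayed: constants, flow, tuning, the infrared threshold, the (2.5)
side condition, the two RELATIVE class displays, the four tree-slot (ID) binders, the live-price bounds, the seam data.
[folklore] -/
theorem hybridNE7_of_treeBinders_canonLE_rel (D : FiniteEpsData F G) (sh : ε → PEv) {C : T4PrintedShapeBanking.Consts}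
    {rr : ℕ} {β₀ : ℝ} (h : ThresholdOK C F.L rr β₀) (hμ : 0 < C.μ) (d n : ℕ) (Dcap Ncap : ℕ → ℕ)
    -- two largeness conditions on the free bank constants
    (hκ₁ : (d : ℝ) * Real.log F.L + 2 * Real.log 2 ≤ C.κ₁) (hE₀ : Real.log (2 + birthMass C) ≤ C.E₀)
    -- the flow side (⇐ BetaPertH, displayed) and tuning
    {γ₀ γb b β' : ℝ} {pe : ℕ} (hb : 0 ≤ b) (hlo : FlowStep.BetaLowerH b γ₀ D.βfun)
    (hhi : FlowStep.BetaUpperH β' γ₀ D.βfun) (hγ : γb ≤ γ₀) (hγβ : γb ^ 2 * β' < 1)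
    (S : B14FlowStep.SmallnessFor γb β' β₀ F.L pe) (hp₀ : C.p₀ ≤ pe) (hrr : rr ≤ pe)
    {g : ℝ} {g₀ : ℕ → ℝ} (ht : D.Tuned γb g g₀)
    (hir : irThresholdTLE C F.L rr β₀ ≤ Real.log (g ^ 2)⁻¹)
    -- H3, RE-CUT: the bad classes are live classes; the weights are non-negative; THE TWO RELATIVE CLASS DISPLAYS
    (bad_subset : ∀ K t, |t| ≤ l₀ → K₀ ≤ K → Bad' K t ⊆ classIndex π T K)
    (hA0 : ∀ K t, |t| ≤ l₀ → K₀ ≤ K → ∀ τ ∈ T K, 0 ≤ A K t τ)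
    (hA0' : ∀ K t, |t| ≤ l₀ → K₀ ≤ K → ∀ τ ∈ T K, 0 ≤ A' K t τ)
    (hFq : ∀ K t, |t| ≤ l₀ → K₀ ≤ K → ∀ c ∈ Bad' K t, 0 ≤ Fq K c)
    (hFq' : ∀ K t, |t| ≤ l₀ → K₀ ≤ K → ∀ c ∈ Bad' K t, 0 ≤ Fq' K c)
    (fibRel : ∀ K t, |t| ≤ l₀ → K₀ ≤ K → ∀ c ∈ Bad' K t,
      classWeight π T A K t c ≤ Fq K c * ∑ σ ∈ T K, A K t σ)
    (fibRel' : ∀ K t, |t| ≤ l₀ → K₀ ≤ K → ∀ c ∈ Bad' K t,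
      classWeight π T A' K t c ≤ Fq' K c * ∑ σ ∈ T K, A' K t σ)
    -- the (2.5) side condition on the size function the (ID) data are built over
    (R : ℕ → ℕ → ℕ) (hR : ∀ K s, s ≤ K → B14.IsRj F.L rr ((D.C ⟨K, F.m, g₀ K⟩).flow.g s) (R K s))
    -- the four TREE-SLOT (ID) binders over the canonical cells and the canonical run family, LE form
    (y : ℕ → ℕ → (Fin d → ℕ) → Gen PEv → ℝ)
    (hy0 : ∀ K, ∀ j ≤ K, ∀ z ∈ cellN d n F.L K (K - j), ∀ Gs ∈ canonFam Dcap Ncap K j, 0 ≤ y K j z Gs)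
    (hlabTLE : ∀ K, K₀ ≤ K → ∀ j ≤ K, ∀ z ∈ cellN d n F.L K (K - j), ∀ Gs ∈ canonFam Dcap Ncap K j,
      y K j z Gs ≤ 0 ∨ ∃ G' : Gen ε, ConsistentTLE sh C K (R K) G' ∧ G'.WF (dictWT sh (R K) C.n₁) ∧
        K < G'.reach (dictWT sh (R K) C.n₁) ∧ relabel (shape ∘ sh) G' = Gs ∧
        y K j z Gs ≤ ((F.L : ℝ) ^ d) ^ partnerAges (PEv.step ∘ sh) G' *
          (Real.exp (-credits (credit C (D.C ⟨K, F.m, g₀ K⟩).flow.g ∘ sh) G') *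
            Real.exp (lifeCost (dictWT sh (R K) C.n₁) (costT sh C K (R K)) G')))
    (str : ℕ → κc → Finset (BSlot (Fin d → ℕ) PEv))
    (hinj : ∀ K t, |t| ≤ l₀ → K₀ ≤ K → Set.InjOn (str K) (Bad' K t))
    (hstr : ∀ K t, |t| ≤ l₀ → K₀ ≤ K → ∀ cl ∈ Bad' K t,
      str K cl ⊆ bliveSlots (cellN d n F.L) (canonFam Dcap Ncap) K ∧
        ∃ o ∈ boldSlots (cellN d n F.L) (canonFam Dcap Ncap) jhalf K, o ∈ str K cl)
    -- the live prices are below the slot-price family weights (both runs)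
    (hF : ∀ K t, |t| ≤ l₀ → K₀ ≤ K → ∀ cl ∈ Bad' K t, Fq K cl ≤ famWeight (bslotPrice (y K)) (str K cl))
    (hF' : ∀ K t, |t| ≤ l₀ → K₀ ≤ K → ∀ cl ∈ Bad' K t, Fq' K cl ≤ famWeight (bslotPrice (y K)) (str K cl))
    -- the seam's other inputs (NE7c socket, NE7 core budget, four summable rates)
    (hSh : ShellWeightBound l₀ T A A' shA shB Wsh)
    (hTB : ReindexedBudget l₀ vol T (fun K t τ => A K t τ - shA K t τ) (fun K t τ => A' K t τ - shB K t τ)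
      (badOfClass π T Bad') Cc Rr CcRec RrRec ν u s₂ q₀ r s)
    (hr : Summable r) (hu : Summable u) (hs : Summable s) (hs₂ : Summable s₂) :
    ∃ K₁ K₂, K₀ ≤ K₁ ∧ HybridNE7 l₀ vol (fun K => T (K₁ + (K₂ + K))) (fun K => A (K₁ + (K₂ + K)))
      (fun K => A' (K₁ + (K₂ + K))) (fun K => badOfClass π T Bad' (K₁ + (K₂ + K)))
      (fun K => 1 * recordsBudget (birthMass C) C.κ₁ ((n : ℝ) ^ d) ((F.L : ℝ) ^ d) (Real.log 2) jhalf (K₁ + (K₂ + K)))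
      (fun K => shA (K₁ + (K₂ + K))) (fun K => shB (K₁ + (K₂ + K))) (fun K => Wsh (K₁ + (K₂ + K)))
      (fun K => (r (K₁ + (K₂ + K)) + u (K₁ + (K₂ + K))) + (s (K₁ + (K₂ + K)) + s₂ (K₁ + (K₂ + K)))) := by
  -- (i) the typed flow along the tuned runs, clamped at the cutoff
  obtain ⟨h27, h29, hx1, -⟩ := flowBinders_of_tuned D hb hlo hhi hγ hγβ S hp₀ hrr ht R hR
  set gr : ℕ → ℕ → ℝ := fun K s => (D.C ⟨K, F.m, g₀ K⟩).flow.g (min s K) with hgr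
  have h27' : ∀ K, K₀ ≤ K → B14.FlowIneq27 (gr K) β' β₀ C.p₀ K := fun K _ => flowIneq27_clamp (h27 K)
  have h29' : ∀ K, K₀ ≤ K → B14FlowStep.FlowIneq29 (R K) (gr K) F.L β' β₀ K := fun K _ => flowIneq29_clamp (h29 K)
  have hR' : ∀ K, K₀ ≤ K → ∀ s, s ≤ K → B14.IsRj F.L rr (gr K s) (R K s) := by
    intro K _ s hs
    show B14.IsRj F.L rr ((D.C ⟨K, F.m, g₀ K⟩).flow.g (min s K)) (R K s)
    rw [min_eq_left hs]; exact hR K s hs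
  have hx1' : ∀ K, K₀ ≤ K → ∀ s, s ≤ K → 1 ≤ Real.log ((gr K s) ^ 2)⁻¹ := by
    intro K _ s hs
    show 1 ≤ Real.log (((D.C ⟨K, F.m, g₀ K⟩).flow.g (min s K)) ^ 2)⁻¹
    rw [min_eq_left hs]; exact hx1 K s hs
  have hir' : ∀ K, K₀ ≤ K → irThresholdTLE C F.L rr β₀ ≤ Real.log ((gr K K) ^ 2)⁻¹ := by
    intro K _
    show _ ≤ Real.log (((D.C ⟨K, F.m, g₀ K⟩).flow.g (min K K)) ^ 2)⁻¹
    rw [min_self, (ht K).2]; exact hir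
  have hP : ∀ K s, 0 ≤ p0Profile C.A₀ C.p₀ (gr K s) := fun K s =>
    p0Profile_nonneg_of_one_le_log C.p₀ h.A₀_pos.le (hx1 K (min s K) (min_le_right s K))
  -- (iii) the two `Regeneration` runs FROM THE RELATIVE CLASS DISPLAYS, constant `1`
  have hA : Regeneration l₀ π T A Bad' (relDead π T A Fq) Fq (fun _ _ => 1)
      (fun K t => ∑ σ ∈ T K, A K t σ) (fun K t => ∑ σ ∈ T K, A K t σ) 1 K₀ :=
    regeneration_of_relativeClasses bad_subset hA0 hFq fibRel
  have hA' : Regeneration l₀ π T A' Bad' (relDead π T A' Fq') Fq' (fun _ _ => 1)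
      (fun K t => ∑ σ ∈ T K, A' K t σ) (fun K t => ∑ σ ∈ T K, A' K t σ) 1 K₀ :=
    regeneration_of_relativeClasses bad_subset hA0' hFq' fibRel'
  have hCn : (0 : ℝ) ≤ 1 := zero_le_one
  have hFm : ∀ K t, |t| ≤ l₀ → K₀ ≤ K → ∀ cl ∈ Bad' K t,
      Fq K cl * 1 ≤ famWeight (bslotPrice (y K)) (str K cl) := fun K t ht hK cl hcl => by
    rw [mul_one]; exact hF K t ht hK cl hcl
  have hFm' : ∀ K t, |t| ≤ l₀ → K₀ ≤ K → ∀ cl ∈ Bad' K t,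
      Fq' K cl * 1 ≤ famWeight (bslotPrice (y K)) (str K cl) := fun K t ht hK cl hcl => by
    rw [mul_one]; exact hF' K t ht hK cl hcl
  -- (ii) cells, matching scale, rates
  have hL1 : 1 ≤ F.L := le_trans (by norm_num) (two_le_L F)
  have hLpos : (0 : ℝ) < F.L := by exact_mod_cast (lt_of_lt_of_le (by norm_num) hL1)
  obtain ⟨hrate, h1, hx⟩ := treeRates_of_large hL1 d (birthMass_nonneg hμ) hκ₁ hE₀
  -- the labelled-price binder in the LE exit's `Δ = 1` form, over the clamped run
  have hlab' : ∀ K, K₀ ≤ K → ∀ j ≤ K, ∀ z ∈ cellN d n F.L K (K - j), ∀ Gs ∈ canonFam Dcap Ncap K j,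
      y K j z Gs ≤ 0 ∨ ∃ G' : Gen ε, ConsistentTLE sh C K (R K) G' ∧ G'.WF (dictWT sh (R K) C.n₁) ∧
        K < G'.reach (dictWT sh (R K) C.n₁) ∧ relabel (shape ∘ sh) G' = Gs ∧
        y K j z Gs ≤ 1 * (((F.L : ℝ) ^ d) ^ partnerAges (PEv.step ∘ sh) G' *
          (Real.exp (-credits (credit C (gr K) ∘ sh) G') *
            Real.exp (lifeCost (dictWT sh (R K) C.n₁) (costT sh C K (R K)) G'))) := by
    intro K hK j hj z hz Gs hGs
    rcases hlabTLE K hK j hj z hz Gs hGs with h0 | ⟨G', hc, hw, hreach, hrel, hy⟩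
    · exact Or.inl h0
    · refine Or.inr ⟨G', hc, hw, hreach, hrel, ?_⟩
      rw [one_mul, credits_clampLE sh C _ hc]
      exact hy
  have hmain := relWeightBound_canon_of_irThresholdLE sh h hμ (cellN d n F.L) (V := (n : ℝ) ^ d)
    (Λ := (F.L : ℝ) ^ d) (by positivity) (pow_pos hLpos d) (card_cellN_le d n hL1) Dcap Ncap jhalf jhalf_le
    (c := 1 / 2) (by norm_num) half_le_sub_jhalf (Δ := 1) le_rfl hA hA' hCn R gr (fun _ => β') h27' h29' hR' hx1'
    hir' hP (Real.log_nonneg one_le_two) hrate (pow_nonneg hLpos.le d) h1 hx y hy0 hlab' str hinj hstr hFm hFm'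
  have e0 : (1 : ℝ) * birthMass C = birthMass C := one_mul _
  rw [e0] at hmain
  exact hybridNE7_of_eventually hmain hSh hTB hr hu hs hs₂

end ExitLevel


/-! ## §2 For IR-103-2 («count DERIVED»): the RELATIVE display passes from the FINE member families to the COARSE slot classes -/

section Coarse

variable {ε γ ι ω : Type*} [DecidableEq γ] [DecidableEq ω]
variable {sh : ε → PEv} {mem : ℕ → ι → Finset (γ × Gen ε)} {jstar : ℕ → ℕ} {T : ℕ → Finset ι} {l₀ : ℝ} {K₀ : ℕ}
  {gmem : ℕ → ι → Finset ω} {gslot : ω → BSlot γ PEv} {A : ℕ → ℝ → ι → ℝ} {q : ℕ → Finset ω → ℝ}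

/-- **THE RELATIVE DISPLAY OVER THE COARSE CLASSES FROM THE RELATIVE DISPLAY OVER THE FINE ONES** (the `_rel` twin of
`HistoryAssemblyMult.resum_coarse`, for the «count DERIVED» road IR-103-2): when the slot family of every term's fine
family is its coarse class, the fibre of a slot class is the disjoint union of the fine fibres with that slot family;
summing the fine displays `Σ_{fibre k} A ≤ q K k · Σ_T A` gives the coarse display with quotient
`RfC mem jstar T gmem gslot (fun _ _ => 1) q K c = Σ_{k ↦ c} q K k`. [folklore] -/
theorem fibRel_coarse
    (hslots : ∀ K, K₀ ≤ K → ∀ τ ∈ T K, (gmem K τ).image gslot = bstrOf sh mem K τ)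
    (fibM : ∀ K t, |t| ≤ l₀ → K₀ ≤ K → ∀ k ∈ badGMems mem jstar T gmem K,
      ∑ τ ∈ fibre gmem T K k, A K t τ ≤ q K k * ∑ σ ∈ T K, A K t σ) :
    ∀ K t, |t| ≤ l₀ → K₀ ≤ K → ∀ c ∈ badClasses sh mem jstar T K,
      classWeight (bstrOf sh mem) T A K t c ≤
        RfC mem jstar T gmem gslot (fun _ _ => 1) q K c * ∑ σ ∈ T K, A K t σ := by
  intro K t ht hK c hc
  have hmaps : ∀ τ ∈ fibre (bstrOf sh mem) T K c,
      gmem K τ ∈ (badGMems mem jstar T gmem K).filter fun k => k.image gslot = c := by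
    intro τ hτ
    obtain ⟨hbad, he⟩ := mem_badTerms_of_mem_fibre hc hτ
    exact mem_filter.2 ⟨mem_badGMems_of_mem hbad, by rw [hslots K hK τ (mem_fibre.1 hτ).1, he]⟩
  unfold classWeight
  rw [RfC, ← sum_fiberwise_of_maps_to hmaps, sum_mul]
  refine sum_le_sum fun k hk => ?_
  obtain ⟨hkb, hkc⟩ := mem_filter.1 hk
  have hfib : (fibre (bstrOf sh mem) T K c).filter (fun τ => gmem K τ = k) = fibre gmem T K k := by
    ext τ
    simp only [mem_filter, mem_fibre]
    constructor
    · rintro ⟨⟨hT, -⟩, hτk⟩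
      exact ⟨hT, hτk⟩
    · rintro ⟨hT, hτk⟩
      refine ⟨⟨hT, ?_⟩, hτk⟩
      rw [← hslots K hK τ hT, hτk, hkc]
  rw [hfib, one_mul]
  exact fibM K t ht hK k hkb

end Coarse

end

end Summit.QuantumFields.BalabanUV.T4Continuum.NE7b.TreeBindersRel
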